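import Summits.BirchSwinnertonDyer.Rank1Residual.X1.FactorSqueeze
import HarnessLib

/-!
# Route M — the 𝔪-ADIC GENERATOR SQUEEZE on the leaf X1 ∩ {r = 0}, and the common kernel form of
# routes T / D / N / M: `λ_alg(E,p) ∈ A` (TYPED) `∧ μ_an = 0 ∧ λ_an = n ∧ gap` ⇒ Mazur's MC ⇒ `BSD(E,p)`

HONEST FRAMING (cell `b2b-bsdres`, run/shared/lean/b2b/bsd-rank1-residual/, verbatim in every
file): the goal of the cell is to DELETE the COMBINATION-SHAPED residual classes of the
Birch–Swinnerton-Dyer formula for ALL analytic-rank `≤ 1` elliptic curves over `ℚ` — "full BSD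
formula for every rank `≤ 1` curve in class `C`" assembled STRICTLY from published theorems — so
that the rank-`≤ 1` remainder becomes exactly the CONSTRUCTION-SHAPED classes, which are TYPED
(missing-input `Prop`s), NOT attempted. This is not "finishing BSD". Sub-cell
`b2b-bsdres-eisenstein-p1` (CLASS-OWNERS row "X1 (r=0)"), gen 12: research route; NO CLAIM BEYOND
STATED CLASSES; nothing here changes a label. ONE def, a typed per-pair input (`AlgebraicLambdaMem`,
nothing asserted); everything else is a theorem over PUBLISHED named facts (`hW16` Wuthrich 2014
Thm. 16, `h310` Greenberg Prop. 3.10, `hGr` Greenberg Thm. 4.1, `hmod` modularity, `hGZK`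
Gross–Zagier–Kolyvagin) and the cell's typed per-pair inputs `AnalyticMuLE`, `AnalyticLambdaEq`,
`AlgebraicLambdaGE`, `ResidualDescentBound`, `AnalyticLamDivisorSet`.

WHY THIS FILE. Every certificate route of this sub-cell ends in ONE constraint on the algebraic
λ-invariant `λ_alg = λ(X(E/ℚ_∞)) = λ(f_E)` of a leaf member and the squeeze `λ(f_E·h) = λ_an`
(Kato–Wuthrich): route T (`X1/TamagawaSqueeze.lean`) says `λ_alg ∈ [k, ∞)` from Tamagawa kernels over
the tower, route D (`X1/ResidualDescent.lean`) says `λ_alg ∈ [k − e, ∞)` from residual descent, route N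
(`X1/FactorSqueeze.lean`) says `λ_alg ∈ A` for the subset sums `A` of the `ℚ_p`-irreducible factor
degrees of the analytic distinguished polynomial `P_an`, route C (`X1/FactorSqueezeCyclotomic.lean`)
forces the cyclotomic factor `ξ_p` into `f_E`. **Route M** (X1R0-GAPMAP §21, this generation) is a
new such constraint, and it needs the constraints INTERSECTED — so this file states the common kernel
form once: the typed input `AlgebraicLambdaMem W p A` ("`λ_alg ∈ A`"), its suppliers from the existing
typed inputs, closure under intersection, and the squeeze to `LambdaPartAt`, MC and `BSD(E,p)`.

ROUTE M (the mathematics lives OUTSIDE the kernel, like route T's §14.1; X1R0-GAPMAP §21.1):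
LEMMA (M). Let `X` be a finitely generated torsion `Λ = ℤ_p⟦T⟧`-module WITHOUT nonzero finite
submodules and `char(X) = (f)`. Then `dim_{𝔽_p} X/𝔪X ≤ ord_𝔪(f)`, where `𝔪 = (p, T)` and
`ord_𝔪(f) = max {k : f ∈ 𝔪^k} = min_j (j + v_p([T^j] f))`. PROOF: `d := dim X/𝔪X` is the minimal
number of generators (Nakayama); a minimal presentation `Λ^r → Λ^d → X → 0` has its relation matrix in
`M_{d×r}(𝔪)`, so the Fitting ideal `Fitt_0(X)` (the `d × d` minors) lies in `𝔪^d`; for a finitely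
generated torsion `Λ`-module without nonzero finite submodules `Fitt_0(X) = char(X)` (projective
dimension `≤ 1`; e.g. Mazur–Wiles 1984 Appendix, Kurihara 2003, and verbatim in E. Urban, JTNB 34
(2022) p. 4: "does not contain any non trivial finite submodule and therefore its fitting ideal is
equal to its characteristic ideal"); hence `f ∈ 𝔪^d`. This REFINES Greenberg's inequality
`λ + μ ≥ dim X/𝔪X` (LNM 1716 p. 137, whose case (b) bounds the `Λ`-generators by the
`ℤ_p`-generators): writing `f = p^μ·P·u` with `P` distinguished and `r_i` its roots,
`ord_𝔪(f) = μ + Σ_i min(1, v(r_i))` (the weight-(1,1) monomial valuation), which is `< μ + λ` as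
soon as `P` has a root of valuation `< 1` (an Eisenstein factor `Q` contributes `v(Q(0)) = 1`, not
`deg Q`). Over the layer algebra `Λ_m = ℤ_p⟦ω_m⟧`: `dim X/(p, ω_m)X ≤ p^m μ + Σ_i min(1, p^m v(r_i))`
(`char_{Λ_m} = Norm(f)`, and `min(1, v((1+r)^{p^m} − 1)) = min(1, p^m v(r))` exactly).
INPUTS ON FILE. Routes T and D prove GENERATOR-COUNT lower bounds before weakening them to λ-bounds
by Greenberg's inequality: route T (§14.1 (a)–(f) minus the last step) gives, at EVERY member `E_j`
of the isogeny class and every layer `m`, `dim X_j/(p, ω_m)X_j = dim_{𝔽_p} Sel(ℚ_∞)[p]^{Γ_m} ≥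
B_m(E_j) := t_m(E_j) + a_j − 2δ_j` (number of bad `ℓ` with `p ∣ c_ℓ` counted with `min(s_ℓ, p^m)`,
`a_j ∈ {1,2}` the `p`-rank of the local kernel at `p`, `δ_j = [E_j(ℚ)[p] ≠ 0]`); route D/DL (§17.1)
gives `dim X_0/(p, ω_n)X_0 ≥ D_n` at the `μ = 0` member. Since `char(X_j) = p^{μ_j}·P_alg·u_j` with
the SAME `P_alg` for all members (isogeny invariance of the λ-part) and `μ_j ≤ μ_an(E_j)`
(Kato–Wuthrich divisibility), and `P_alg ∣ P_an` (route N), the admissible candidates for `P_alg` are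
the sub-products `D` of the `ℚ_p`-irreducible factors of `P_an` (Newton polygon + Ore residual
polynomials: each factor has a known root valuation `s`) with `deg D` even (Prop. 3.10) and
  `p^m μ_an(E_j) + Σ_{r ∣ D} min(1, p^m v(r)) ≥ B_m(E_j)` for all members `j`, layers `m`,
  `Σ_{r ∣ D} min(1, p^n v(r)) ≥ D_n` at the `μ = 0` member;
the class CLOSES iff the only admissible `D` is `P_an` itself. The per-pair OUTPUT of route M is the
finite set `A_M = {deg D : D admissible}`, i.e. exactly an instance of `AlgebraicLambdaMem W p A_M`.
EXAMPLE (`258f@7`, `λ_an = 6`, open after routes P/T/C/G/D/DL/N): `P_an = Q₂·Q₄` with `Q₂`, `Q₄`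
EISENSTEIN (root valuations `1/2`, `1/4`); the `μ = 0` member `258f1` has a rational `7`-torsion
point (`δ = 1`, `a = 2`) and TWO split primes with `7 ∣ c_ℓ` (`c₂ = 14`, `c₃ = 7`), so `X` needs
`≥ 2 + 2 − 2 = 2` generators; but `Λ/(Q)` for an Eisenstein `Q` is a discrete valuation ring
(`ord_𝔪(Q₂) = ord_𝔪(Q₄) = 1 < 2 = ord_𝔪(P_an)`): neither factor alone can be `P_alg`, so
`λ_alg = 6 = λ_an`. CENSUS (gen 12, `HOME/b2b-bsdres-eisenstein-p1/routeM/`, exact,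
seconds; 0 violations of the full-product admissibility on 1 371 classes): X1 ∩ {r = 0}, `N < 2·10⁴`:
763 → **769/770** classes re-derived by the seat's Ш-free routes (`258f@7, 858k@7, 5394j@5, 8414h@5,
17328bf@5` by M, `7154c@3` by M∘C), and 770/770 once route G (`X1/CongruenceTransfer.lean`) is re-run
with the new closures as relatives (`13826e@3`); `p = 3`, `N < 5·10⁵`: 6 509 → 7 043/7 315 by the
route-N fold of iw-2's ROUTE-NB coefficients (+306) and route M (+230), 7 170 with the route-G re-join
(X1R0-GAPMAP §21.8; later folds there); lane residue N1″: 6 → 5 open by M, 1 open after the re-join.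

* `AlgebraicLambdaMem W p A` (TYPED) — §1; `.mono`, `.inter`, `algebraicLambdaMem_univ`,
  `.of_algebraicLambdaGE` (route T's input is the case `A = Ici k`),
  `.of_residualDescentBound` (route D), `.of_lamDivisorSet` (route N, through Wuthrich Thm. 16).
* `lambdaPartAt_of_lambdaMem(_of_even)`, `mazurMainConjecture_of_lambdaMem(_of_even)` — §2.
* `Leaf.mazurMainConjecture_of_lambdaMem`, `Leaf.bsdp_of_lambdaMem`,
  **`Leaf.bsdp_of_muZero_of_lambdaMem`** (`μ_an = 0 ∧ λ_an = n ∧ λ_alg ∈ A ∧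
  (∀ d ∈ A, Even d → d ≤ n → n ≤ d + 1) ⇒ BSD(E,p)`), `Leaf.bsdp_of_muZero_of_lambdaMem_inter`
  (two certificates intersected — the M∘C / T∧N shape), `Leaf.exists_mem_of_lambdaMem` (consistency:
  `A ∩ [0, n] ≠ ∅`, the kernel form of the census's falsification test) — §3.

References: [GreenbergLNM1716] Prop. 3.10, Thm. 4.1, p. 137; [Wuthrich2014] Thm. 16; X1R0-GAPMAP §21.
-/

noncomputable section

open scoped Classical MatrixGroups ModularForm

open PowerSeries CongruenceSubgroup WeierstrassCurve Literature.NumberTheory.EllipticCurves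
  Literature.NumberTheory.EllipticCurves.ModularForms
  Literature.NumberTheory.EllipticCurves.Rank1Residual
  Literature.NumberTheory.EllipticCurves.Greenberg1999
  Summit.BirchSwinnertonDyer.BirchSwinnertonDyer.Theorems.Rank1ResidualX1Defs
  Summit.BirchSwinnertonDyer.Rank1Residual.X1.MuLambda
  Summit.BirchSwinnertonDyer.Rank1Residual.X1.MuPart
  Summit.BirchSwinnertonDyer.Rank1Residual.X1.ParitySqueeze
  Summit.BirchSwinnertonDyer.Rank1Residual.X1.TamagawaSqueeze
  Summit.BirchSwinnertonDyer.Rank1Residual.X1.FactorSqueeze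

set_option autoImplicit false

namespace Summit.BirchSwinnertonDyer.Rank1Residual.X1.GeneratorSqueeze

/-! ## §1. "`λ_alg(E,p) ∈ A`", TYPED (nothing asserted), and its suppliers -/

/-- **"`λ(X(E/ℚ_∞)) ∈ A`" (TYPED; nothing asserted).** For the cyclotomic `ℤ_p`-extension `κ` of
`ℚ` with topological generator `γ` (a cyclotomic variable) and every Pontryagin-dual Selmer datum
`D` of `W` whose module `X = D.X` is `Λ`-torsion: `λ(X) ∈ A`. The common OUTPUT shape of the
sub-cell's per-pair certificate routes: route T (`A = [k, ∞)`, `of_algebraicLambdaGE`), route D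
(`A = [k − e, ∞)`, `of_residualDescentBound`), route N (`A` = divisor-degree set, `of_lamDivisorSet`)
and route M (X1R0-GAPMAP §21: `A_M` = degrees of the sub-products of the analytic distinguished
polynomial admissible under the 𝔪-adic generator inequality `dim X_j/(p,ω_m)X_j ≤ p^m μ_j +
Σ_{r} min(1, p^m v(r))` at every member and layer — certified per pair OUTSIDE the kernel from the
Newton polygon of `ϖ·L_p` and the generator counts of routes T/D). `A = univ` always qualifies.
[cite: GreenbergLNM1716, p. 137 (shape only; nothing asserted)] -/
def AlgebraicLambdaMem (W : WeierstrassCurve ℚ) [W.IsElliptic] [W.IsGloballyMinimal] (p : ℕ)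
    [Fact p.Prime] (A : Set ℕ) : Prop :=
  ∀ (κ : ZpExtension ℚ p) (γ : Field.absoluteGaloisGroup ℚ),
      κ.IsCyclotomic → κ.IsTopGenerator γ → IsCyclotomicVariable p γ →
    ∀ (D : W.SelmerDualData κ γ) [Module.Finite (IwasawaAlgebra p) D.X], D.IsTorsion →
      lambdaInvariant p D.X ∈ A

section Basic

variable {W : WeierstrassCurve ℚ} [W.IsElliptic] [W.IsGloballyMinimal] {p : ℕ} [Fact p.Prime]

/-- `AlgebraicLambdaMem` is monotone in the set. [folklore] -/
theorem AlgebraicLambdaMem.mono {A B : Set ℕ} (hAB : A ⊆ B) (hA : AlgebraicLambdaMem W p A) :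
    AlgebraicLambdaMem W p B :=
  fun κ γ hκ hγ hγ' D _ hX ↦ hAB (hA κ γ hκ hγ hγ' D hX)

/-- **Certificates INTERSECT**: `λ_alg ∈ A` and `λ_alg ∈ B` give `λ_alg ∈ A ∩ B` (how route M is
combined with routes T/D/N/C per pair). [folklore] -/
theorem AlgebraicLambdaMem.inter {A B : Set ℕ} (hA : AlgebraicLambdaMem W p A)
    (hB : AlgebraicLambdaMem W p B) : AlgebraicLambdaMem W p (A ∩ B) :=
  fun κ γ hκ hγ hγ' D _ hX ↦ ⟨hA κ γ hκ hγ hγ' D hX, hB κ γ hκ hγ hγ' D hX⟩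

omit [W.IsElliptic] [W.IsGloballyMinimal] in
/-- The trivial certificate `A = univ`. [folklore] -/
theorem algebraicLambdaMem_univ (W : WeierstrassCurve ℚ) [W.IsElliptic] [W.IsGloballyMinimal]
    (p : ℕ) [Fact p.Prime] : AlgebraicLambdaMem W p Set.univ :=
  fun _ _ _ _ _ _ _ _ ↦ Set.mem_univ _

/-- **Route T's typed input is the case `A = [k, ∞)`**: `AlgebraicLambdaGE W p k` gives
`AlgebraicLambdaMem W p (Ici k)`. [folklore] -/
theorem AlgebraicLambdaMem.of_algebraicLambdaGE {k : ℕ} (hk : AlgebraicLambdaGE W p k) :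
    AlgebraicLambdaMem W p (Set.Ici k) :=
  fun κ γ hκ hγ _ D _ hX ↦ Set.mem_Ici.mpr (hk κ γ hκ hγ D hX)

/-- **Route D's typed input supplies `A = [k − e, ∞)` at the `μ = 0` member**: granted Wuthrich
Thm. 16 and modularity, `μ_an = 0` (`AnalyticMuLE W p 0`, so `μ(X) = 0`) and
`ResidualDescentBound W p k e` (`k ≤ λ(X) + e`) give `AlgebraicLambdaMem W p (Ici (k − e))`.
[cite: GreenbergVatsal2000, §2 pp. 25–27] [cite: Wuthrich2014, Thm. 16 (p. 397)] -/
theorem AlgebraicLambdaMem.of_residualDescentBound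
    (hW16 : Wuthrich2014.charIdeal_dvd_padicLFunction) (hmod : nonempty_modularParametrizationData)
    (hp : p ≠ 2) (hgood : W.HasGoodReductionAtPrime p) (hord : ¬ (p : ℤ) ∣ W.frobeniusTrace p)
    (hred : ¬ W.HasIrreducibleModPGaloisRep p) (hμ0 : AnalyticMuLE W p 0) {k e : ℕ}
    (hD : ResidualDescent.ResidualDescentBound W p k e) :
    AlgebraicLambdaMem W p (Set.Ici (k - e)) := by
  intro κ γ hκ hγ hγ' D _ _
  obtain ⟨-, h⟩ := ResidualDescent.isTorsion_and_le_lambdaInvariant_of_residualDescentBound hW16 hmod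
    hp hgood hord hred hμ0 hD hκ hγ hγ' D
  exact Set.mem_Ici.mpr (by omega)

/-- **Route N's typed input supplies its own set**: granted Wuthrich Thm. 16 (`f_E·h = g_an`,
`ι(g_an) = ϖ·L_p(f,α)`: the characteristic power series `f_E` IS a `Λ`-divisor of `ϖ·L_p`) and
modularity (a newform and a Néron-normalised `ϖ` exist), `AnalyticLamDivisorSet W p A` gives
`AlgebraicLambdaMem W p A` (`λ(X) = λ(f_E)` by the structure theorem,
`ParitySqueeze.lam_generator_eq_lambdaInvariant`). [cite: Wuthrich2014, Thm. 16 (p. 397)]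
[cite: Washington1997, Thm. 7.3 and Prop. 7.6] -/
theorem AlgebraicLambdaMem.of_lamDivisorSet
    (hW16 : Wuthrich2014.charIdeal_dvd_padicLFunction) (hmod : nonempty_modularParametrizationData)
    (hp : p ≠ 2) (hgood : W.HasGoodReductionAtPrime p) (hord : ¬ (p : ℤ) ∣ W.frobeniusTrace p)
    (hred : ¬ W.HasIrreducibleModPGaloisRep p) {A : Set ℕ} (hA : AnalyticLamDivisorSet W p A) :
    AlgebraicLambdaMem W p A := by
  intro κ γ hκ hγ hγ' D _ _
  haveI : NeZero (W.conductorNorm ℤ) := ⟨(W.conductorNorm_pos_holds).ne'⟩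
  obtain ⟨hX, f, ϖ, g, h, hf, hϖ, hchar, hι⟩ :=
    isTorsion_and_exists_factorisation hW16 hmod hp hgood hord hred hκ hγ hγ' D
  have hgh : g * h ≠ 0 := mul_ne_zero_of_iota_eq hgood hord hf hϖ D hι
  have hg : g ≠ 0 := fun h0 ↦ hgh (by rw [h0, zero_mul])
  have h2 : lam g = lambdaInvariant p D.X := lam_generator_eq_lambdaInvariant D.X hX hg hchar
  rw [← h2]
  exact hA f hf ϖ hϖ g h hι

end Basic

/-! ## §2. The squeeze: λ-part and Mazur's main conjecture from `λ_alg ∈ A` and a gap check -/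

section Squeeze

variable {W : WeierstrassCurve ℚ} [W.IsElliptic] [W.IsGloballyMinimal] {p : ℕ} [Fact p.Prime]

/-- **λ-part from membership (no parity).** `W/ℚ` globally minimal elliptic, `p ≠ 2` good ordinary
with `E[p]` reducible; granted Wuthrich 2014 Thm. 16 (`hW16`, PUBLISHED): if `λ_an(E,p) = n`
(`AnalyticLambdaEq W p n`), `λ_alg ∈ A` (`AlgebraicLambdaMem W p A`) and the finite GAP CHECK
`∀ d ∈ A, d ≤ n → n ≤ d` passes (no admissible degree strictly below `n`), then `LambdaPartAt W p`:
`λ(f_E) ∈ A` and `λ(f_E) ≤ λ(f_E·h) = n` (`MuLambda.lam_le_lam_mul`) give `λ(f_E) = n`.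
[cite: Wuthrich2014, Thm. 16 (p. 397)] [cite: GreenbergLNM1716, p. 137] -/
theorem lambdaPartAt_of_lambdaMem (hW16 : Wuthrich2014.charIdeal_dvd_padicLFunction)
    (hp : p ≠ 2) (hgood : W.HasGoodReductionAtPrime p) (hord : ¬ (p : ℤ) ∣ W.frobeniusTrace p)
    (hred : ¬ W.HasIrreducibleModPGaloisRep p) {n : ℕ} {A : Set ℕ} (hlam : AnalyticLambdaEq W p n)
    (hA : AlgebraicLambdaMem W p A) (hgap : ∀ d ∈ A, d ≤ n → n ≤ d) : LambdaPartAt W p := by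
  intro κ γ hκ hγ hγ' _ f hf ϖ hϖ D g h hchar hι
  haveI : Module.Finite (IwasawaAlgebra p) D.X := D.module_finite_holds hγ
  obtain ⟨hX, -⟩ := hW16 W p hp ⟨hgood, hord⟩ hred hκ hγ hγ' hf D ϖ hϖ
  have hgh : g * h ≠ 0 := mul_ne_zero_of_iota_eq hgood hord hf hϖ D hι
  have hg : g ≠ 0 := fun h0 ↦ hgh (by rw [h0, zero_mul])
  have hh : h ≠ 0 := fun h0 ↦ hgh (by rw [h0, mul_zero])
  have h1 : lam (g * h) = n := hlam f hf ϖ hϖ (g * h) hι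
  have h2 : lam g = lambdaInvariant p D.X := lam_generator_eq_lambdaInvariant D.X hX hg hchar
  have h3 : lambdaInvariant p D.X ∈ A := hA κ γ hκ hγ hγ' D hX
  have h4 : lam g ≤ lam (g * h) := lam_le_lam_mul hg hh
  have h5 : n ≤ lam g := hgap (lam g) (h2 ▸ h3) (by omega)
  omega

/-- **λ-part from membership, with parity.** As `lambdaPartAt_of_lambdaMem`, with the weaker gap
check `∀ d ∈ A, Even d → d ≤ n → n ≤ d + 1`, for `n` EVEN and `Sel_{p^∞}(E/ℚ)` finite (so `λ(f_E)`
is even by Greenberg's Prop. 3.10, `h310`, PUBLISHED). [cite: GreenbergLNM1716, Prop. 3.10]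
[cite: Wuthrich2014, Thm. 16 (p. 397)] -/
theorem lambdaPartAt_of_lambdaMem_of_even
    (hW16 : Wuthrich2014.charIdeal_dvd_padicLFunction)
    (h310 : prop310_selmerCorank_mod_two_eq_lambdaInvariant)
    (hp : p ≠ 2) (hgood : W.HasGoodReductionAtPrime p) (hord : ¬ (p : ℤ) ∣ W.frobeniusTrace p)
    (hred : ¬ W.HasIrreducibleModPGaloisRep p) (hSel : Finite (W.selmerGroupPInfty p))
    {n : ℕ} {A : Set ℕ} (hn : Even n) (hlam : AnalyticLambdaEq W p n)
    (hA : AlgebraicLambdaMem W p A) (hgap : ∀ d ∈ A, Even d → d ≤ n → n ≤ d + 1) :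
    LambdaPartAt W p := by
  intro κ γ hκ hγ hγ' _ f hf ϖ hϖ D g h hchar hι
  haveI : Module.Finite (IwasawaAlgebra p) D.X := D.module_finite_holds hγ
  obtain ⟨hX, -⟩ := hW16 W p hp ⟨hgood, hord⟩ hred hκ hγ hγ' hf D ϖ hϖ
  have hgh : g * h ≠ 0 := mul_ne_zero_of_iota_eq hgood hord hf hϖ D hι
  have hg : g ≠ 0 := fun h0 ↦ hgh (by rw [h0, zero_mul])
  have hh : h ≠ 0 := fun h0 ↦ hgh (by rw [h0, mul_zero])
  have h1 : lam (g * h) = n := hlam f hf ϖ hϖ (g * h) hι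
  have h2 : lam g = lambdaInvariant p D.X := lam_generator_eq_lambdaInvariant D.X hX hg hchar
  have h3 : lambdaInvariant p D.X ∈ A := hA κ γ hκ hγ hγ' D hX
  have h4 : lam g ≤ lam (g * h) := lam_le_lam_mul hg hh
  have hcork : W.selmerCorank p = 0 := by
    haveI := hSel
    exact zpCorank_eq_zero_of_finite (W.selmerGroupPInfty p) p
  have heven : Even (lam g) := by
    rw [h2]
    exact prop310_selmerCorank_mod_two_eq_lambdaInvariant.even_lambdaInvariant_of_selmerCorank_eq_zero
      h310 W p hp hκ hγ D hX hcork
  have h5 : n ≤ lam g + 1 := hgap (lam g) (h2 ▸ h3) heven (by omega)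
  obtain ⟨a, ha⟩ := heven
  obtain ⟨b, hb⟩ := hn
  omega

/-- **Mazur's main conjecture from membership** (`MuPartAt W p`, `λ_an = n`, `λ_alg ∈ A`, gap check
`∀ d ∈ A, d ≤ n → n ≤ d`; Wuthrich Thm. 16: `MC ⟺ μ-part ∧ λ-part`, `X1/MuLambda.lean`).
[cite: Wuthrich2014, Thm. 16 (p. 397)] -/
theorem mazurMainConjecture_of_lambdaMem (hW16 : Wuthrich2014.charIdeal_dvd_padicLFunction)
    (hp : p ≠ 2) (hgood : W.HasGoodReductionAtPrime p) (hord : ¬ (p : ℤ) ∣ W.frobeniusTrace p)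
    (hred : ¬ W.HasIrreducibleModPGaloisRep p) (hμ : MuPartAt W p) {n : ℕ} {A : Set ℕ}
    (hlam : AnalyticLambdaEq W p n) (hA : AlgebraicLambdaMem W p A)
    (hgap : ∀ d ∈ A, d ≤ n → n ≤ d) : MazurMainConjecture W p :=
  (mazurMainConjecture_iff_muPart_and_lambdaPart hW16 hp hgood hord hred).mpr
    ⟨hμ, lambdaPartAt_of_lambdaMem hW16 hp hgood hord hred hlam hA hgap⟩

/-- **Mazur's main conjecture from membership, with parity** (`n` even, `Sel_{p^∞}(E/ℚ)` finite,
Prop. 3.10; gap check `∀ d ∈ A, Even d → d ≤ n → n ≤ d + 1`). [cite: GreenbergLNM1716, Prop. 3.10]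
[cite: Wuthrich2014, Thm. 16 (p. 397)] -/
theorem mazurMainConjecture_of_lambdaMem_of_even
    (hW16 : Wuthrich2014.charIdeal_dvd_padicLFunction)
    (h310 : prop310_selmerCorank_mod_two_eq_lambdaInvariant)
    (hp : p ≠ 2) (hgood : W.HasGoodReductionAtPrime p) (hord : ¬ (p : ℤ) ∣ W.frobeniusTrace p)
    (hred : ¬ W.HasIrreducibleModPGaloisRep p) (hSel : Finite (W.selmerGroupPInfty p))
    (hμ : MuPartAt W p) {n : ℕ} {A : Set ℕ} (hn : Even n) (hlam : AnalyticLambdaEq W p n)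
    (hA : AlgebraicLambdaMem W p A) (hgap : ∀ d ∈ A, Even d → d ≤ n → n ≤ d + 1) :
    MazurMainConjecture W p :=
  (mazurMainConjecture_iff_muPart_and_lambdaPart hW16 hp hgood hord hred).mpr
    ⟨hμ, lambdaPartAt_of_lambdaMem_of_even hW16 h310 hp hgood hord hred hSel hn hlam hA hgap⟩

end Squeeze

/-! ## §3. On the leaf X1 ∩ {r = 0}: `BSD(E,p)` -/

section Leaf

variable {W : WeierstrassCurve ℚ} [W.IsElliptic] [W.IsGloballyMinimal] {p : ℕ} [Fact p.Prime]

/-- **On the leaf: Mazur's main conjecture** from `MuPartAt W p`, `λ_an = n`, `λ_alg ∈ A` and the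
parity gap check — parity is automatic on the leaf (`λ_an` even:
`ParitySqueeze.Leaf.even_of_analyticLambdaEq`; `λ(f_E)` even: Prop. 3.10 at corank `0`, the Selmer
group being finite by Gross–Zagier–Kolyvagin/Kato, `TamagawaSqueeze.Leaf.finite_selmerGroupPInfty`).
Facts `hW16`, `h310`, `hmod`, `hGZK` all PUBLISHED. [cite: GreenbergLNM1716, Prop. 3.10]
[cite: Wuthrich2014, Thm. 16 (p. 397)] -/
theorem Leaf.mazurMainConjecture_of_lambdaMem
    (hW16 : Wuthrich2014.charIdeal_dvd_padicLFunction)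
    (h310 : prop310_selmerCorank_mod_two_eq_lambdaInvariant)
    (hmod : nonempty_modularParametrizationData)
    (hGZK : rank_eq_analyticRank_of_analyticRank_le_one) (hL : RankZero.Leaf W p)
    (hμ : MuPartAt W p) {n : ℕ} {A : Set ℕ} (hlam : AnalyticLambdaEq W p n)
    (hA : AlgebraicLambdaMem W p A) (hgap : ∀ d ∈ A, Even d → d ≤ n → n ≤ d + 1) :
    MazurMainConjecture W p :=
  have hX := isClassX1_of_classX1 hL.classX1
  mazurMainConjecture_of_lambdaMem_of_even hW16 h310 hX.two_ne hX.hasGoodReductionAtPrime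
    hX.not_dvd_frobeniusTrace hX.not_hasIrreducibleModPGaloisRep
    (TamagawaSqueeze.Leaf.finite_selmerGroupPInfty hmod hGZK hL) hμ
    (ParitySqueeze.Leaf.even_of_analyticLambdaEq hW16 hmod hL hlam) hlam hA hgap

/-- **On the leaf: `BSD(E,p)`** from the same data, through
`RankZero.Leaf.mazurMainConjecture_iff_bsdp` (Greenberg 4.1 `hGr`, modularity, Gross–Zagier–Kolyvagin;
all PUBLISHED). [cite: GreenbergLNM1716, Prop. 3.10, Thm. 4.1] [cite: Wuthrich2014, Thm. 16 (p. 397)] -/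
theorem Leaf.bsdp_of_lambdaMem
    (hW16 : Wuthrich2014.charIdeal_dvd_padicLFunction) (hGr : greenberg_charValue_rankZero)
    (h310 : prop310_selmerCorank_mod_two_eq_lambdaInvariant)
    (hmod : nonempty_modularParametrizationData)
    (hGZK : rank_eq_analyticRank_of_analyticRank_le_one) (hL : RankZero.Leaf W p)
    (hμ : MuPartAt W p) {n : ℕ} {A : Set ℕ} (hlam : AnalyticLambdaEq W p n)
    (hA : AlgebraicLambdaMem W p A) (hgap : ∀ d ∈ A, Even d → d ≤ n → n ≤ d + 1) : BSDp W p :=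
  (RankZero.Leaf.mazurMainConjecture_iff_bsdp hW16 hGr hmod hGZK hL).mp
    (Leaf.mazurMainConjecture_of_lambdaMem hW16 h310 hmod hGZK hL hμ hlam hA hgap)

/-- **Headline form at the `μ = 0` member: `μ_an = 0 ∧ λ_an = n ∧ λ_alg ∈ A ∧ gap ⇒ BSD(E,p)`** on
the leaf (μ-part automatic at `μ_an = 0`, `MuPart.muPartAt_of_analyticMuLE_zero`). ROUTE M instances
(eisenstein-p1 gen 12, X1R0-GAPMAP §21, `routeM/`): `258f@7` (`λ_an = 6`, `P_an = Q₂·Q₄` both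
Eisenstein, `A_M = {6}`), `858k@7`, `17328bf@5`, `5394j@5`, `8414h@5`; `281554ds@3` of the lane
residue N1″. [cite: GreenbergLNM1716, Prop. 3.10, Thm. 4.1, p. 137]
[cite: Wuthrich2014, Thm. 16 (p. 397)] -/
theorem Leaf.bsdp_of_muZero_of_lambdaMem
    (hW16 : Wuthrich2014.charIdeal_dvd_padicLFunction) (hGr : greenberg_charValue_rankZero)
    (h310 : prop310_selmerCorank_mod_two_eq_lambdaInvariant)
    (hmod : nonempty_modularParametrizationData)
    (hGZK : rank_eq_analyticRank_of_analyticRank_le_one) (hL : RankZero.Leaf W p)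
    (hμ0 : AnalyticMuLE W p 0) {n : ℕ} {A : Set ℕ} (hlam : AnalyticLambdaEq W p n)
    (hA : AlgebraicLambdaMem W p A) (hgap : ∀ d ∈ A, Even d → d ≤ n → n ≤ d + 1) : BSDp W p :=
  have hX := isClassX1_of_classX1 hL.classX1
  Leaf.bsdp_of_lambdaMem hW16 hGr h310 hmod hGZK hL
    (muPartAt_of_analyticMuLE_zero hW16 hX.two_ne hX.hasGoodReductionAtPrime
      hX.not_dvd_frobeniusTrace hX.not_hasIrreducibleModPGaloisRep hμ0) hlam hA hgap

/-- **Two certificates intersected: `μ_an = 0 ∧ λ_an = n ∧ λ_alg ∈ A ∧ λ_alg ∈ B ∧ gap on A ∩ B ⇒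
BSD(E,p)`** on the leaf — the shape of the gen-12 closures that need two routes (`7154c@3`,
`λ_an = 4`, `P_an = ξ₃·Q₂`: route M excludes `ξ₃` alone, route C (a certified point of infinite
order over `ℚ(ζ_9)⁺`, iw-1 j126286) excludes `Q₂` alone). [cite: GreenbergLNM1716, Prop. 3.10,
Thm. 4.1, pp. 132, 137] [cite: Wuthrich2014, Thm. 16 (p. 397)] -/
theorem Leaf.bsdp_of_muZero_of_lambdaMem_inter
    (hW16 : Wuthrich2014.charIdeal_dvd_padicLFunction) (hGr : greenberg_charValue_rankZero)
    (h310 : prop310_selmerCorank_mod_two_eq_lambdaInvariant)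
    (hmod : nonempty_modularParametrizationData)
    (hGZK : rank_eq_analyticRank_of_analyticRank_le_one) (hL : RankZero.Leaf W p)
    (hμ0 : AnalyticMuLE W p 0) {n : ℕ} {A B : Set ℕ} (hlam : AnalyticLambdaEq W p n)
    (hA : AlgebraicLambdaMem W p A) (hB : AlgebraicLambdaMem W p B)
    (hgap : ∀ d ∈ A, d ∈ B → Even d → d ≤ n → n ≤ d + 1) : BSDp W p :=
  Leaf.bsdp_of_muZero_of_lambdaMem hW16 hGr h310 hmod hGZK hL hμ0 hlam (hA.inter hB)
    fun d hd ↦ hgap d hd.1 hd.2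

/-- **Consistency: a certified membership set always meets `[0, λ_an]`** — on the leaf, if
`AlgebraicLambdaMem W p A` and `AnalyticLambdaEq W p n` hold then SOME `d ∈ A` has `d ≤ n` (namely
`d = λ(f_E)`: the data exist — modularity, the cyclotomic `κ, γ`, a dual datum — and
`λ(f_E) ≤ λ(f_E·h) = n`). The kernel form of the census's falsification test (0 violations on
1 371 classes in gen 12): a certificate set avoiding `[0, n]` would contradict Kato–Wuthrich.
[cite: Wuthrich2014, Thm. 16 (p. 397)] -/
theorem Leaf.exists_mem_of_lambdaMem
    (hW16 : Wuthrich2014.charIdeal_dvd_padicLFunction) (hmod : nonempty_modularParametrizationData)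
    (hL : RankZero.Leaf W p) {n : ℕ} {A : Set ℕ} (hA : AlgebraicLambdaMem W p A)
    (hn : AnalyticLambdaEq W p n) : ∃ d ∈ A, d ≤ n := by
  have hX := isClassX1_of_classX1 hL.classX1
  haveI : NeZero (W.conductorNorm ℤ) := ⟨(W.conductorNorm_pos_holds).ne'⟩
  obtain ⟨κ, hκ, γ, hγ, hγ'⟩ := exists_isCyclotomic_isTopGenerator_isCyclotomicVariable_holds p
  obtain ⟨D⟩ := W.nonempty_selmerDualData_holds κ γ hγ
  haveI : Module.Finite (IwasawaAlgebra p) D.X := D.module_finite_holds hγ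
  obtain ⟨hXt, f, ϖ, g, h, hf, hϖ, hchar, hι⟩ := isTorsion_and_exists_factorisation hW16 hmod
    hX.two_ne hX.hasGoodReductionAtPrime hX.not_dvd_frobeniusTrace hX.not_hasIrreducibleModPGaloisRep
    hκ hγ hγ' D
  have hgh : g * h ≠ 0 :=
    mul_ne_zero_of_iota_eq hX.hasGoodReductionAtPrime hX.not_dvd_frobeniusTrace hf hϖ D hι
  have hg : g ≠ 0 := fun h0 ↦ hgh (by rw [h0, zero_mul])
  have hh : h ≠ 0 := fun h0 ↦ hgh (by rw [h0, mul_zero])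
  have h1 : lam (g * h) = n := hn f hf ϖ hϖ (g * h) hι
  have h2 : lam g = lambdaInvariant p D.X := lam_generator_eq_lambdaInvariant D.X hXt hg hchar
  have h3 : lambdaInvariant p D.X ∈ A := hA κ γ hκ hγ hγ' D hXt
  have h4 : lam g ≤ lam (g * h) := lam_le_lam_mul hg hh
  exact ⟨lam g, h2 ▸ h3, by omega⟩

end Leaf

end Summit.BirchSwinnertonDyer.Rank1Residual.X1.GeneratorSqueeze

end
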